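import Mathlib
import HarnessLib
import Summits.QuantumAdvantage.QuantumAdvantage.Theorems.PumpDialG
import Summits.QuantumAdvantage.AdviceFreeQNC0.WalkAdaptedFarPattern

/-!
# PumpDial I — twist law (1/3): `3·liveInd = 2 − ω^m − ω^{2m}` and the kill lemma for twisted low-degree characters

Lens «minimal-counterexample / extremal reduction» (decomp-qadv-lens-4, generation 26, LAND-REV2): the TWIST LAW
package, cut into chain-imported parts `PumpDialI → PumpDialJ → PumpDialK` (Theses-free: imports only `PumpDialG`,
`AdviceFreeQNC0.WalkAdaptedFarPattern`, HarnessLib, Mathlib) and the junction `PumpDialL` (imports `PumpDialH`).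
The monolithic file of record (`TwistLaw.lean`, farm rc 0 · 0 sorry · axioms {propext, Classical.choice, Quot.sound})
and the full mathematical header live in the lens folder g26.

REV2 (writer review of REV1): the cube-root identities, the `K`-valued path characters `χ_a` and the dual coefficient
functional `L_a` are the cell's (`AdviceFreeQNC0.CharK` in `WalkCharactersK.lean`: `omega_cube`, `omega_pow_mod`,
`omega_sub_sq`, `one_sub_omega_sq_ne_zero`, `omega_sub_ne_zero`, `chiK`, `omega_pow_walkExp_K`, `chiK_sq`, `LfunK`,
`LfunK_add`, `LfunK_smul`, `LfunKLin`, `LfunK_mono`; `TwoShot.pdist_conj_comm` in `TwoShotHard.lean`) and are CITED, not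
restated.  This part keeps only what is new: `(1 − ω)(1 − ω²) = 3`, `1 − ω^{lett b} ≠ 0`, the indicator identity
`three_mul_liveInd`, `omega_pow_two_mul_walkExp`, and the hypothesis-free kill lemmas `LfunK_mono_mul_chiK` /
`LfunK_lowDeg_mul_chiK` (`L_a` kills `Y·χ_b` whenever `deg Y < dist(a,b)`), stated for `CharK.LfunK`.
-/

set_option autoImplicit false
set_option linter.dupNamespace false

namespace Summit.QuantumAdvantage.QuantumAdvantage.Theorems.PumpDial
open Classical
open Finset
open Summit.QuantumAdvantage.AdviceFreeQNC0
open Summit.QuantumAdvantage.AdviceFreeQNC0.CharK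
open Literature.Computability.MetaComplexity Literature.Computability.MetaComplexity.Smolensky

/-! ## Two more cube-root identities -/
section Omega
variable {L : Type*} [Field L] {ω : L}

/-- `(1 − ω)(1 − ω²) = 3`. -/
theorem one_sub_omega_mul (hω : ω ^ 2 + ω + 1 = 0) : (1 - ω) * (1 - ω ^ 2) = 3 := by
  linear_combination (ω - 2) * hω

/-- `1 - ω ≠ 0` (as `(1-ω)(1-ω²) = 3 ≠ 0`). -/
theorem one_sub_omega_ne_zero (hω : ω ^ 2 + ω + 1 = 0) (h3 : (3 : L) ≠ 0) : 1 - ω ≠ 0 := by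
  intro h; apply h3; rw [← one_sub_omega_mul hω, h, zero_mul]

/-- `1 − ω^{lett b} ≠ 0` for both letters. -/
theorem one_sub_omega_pow_lett_ne_zero (hω : ω ^ 2 + ω + 1 = 0) (h3 : (3 : L) ≠ 0) (b : Bool) :
    1 - ω ^ lett b ≠ 0 := by
  unfold lett
  cases b
  · simp only [Bool.false_eq_true, if_false, pow_one]; exact one_sub_omega_ne_zero hω h3
  · simp only [if_true]; exact one_sub_omega_sq_ne_zero hω h3

/-- **the dead/live indicator through the cube root of unity**: `3·𝟙[m ≢ 0] = 2 − ω^m − ω^{2m}`. -/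
theorem three_mul_liveInd (hω : ω ^ 2 + ω + 1 = 0) {n : ℕ} (c : ℕ) (g : Fin (n + 1)) (u : Fin n → Bool) :
    (3 : L) * liveInd L c g u =
      2 - ω ^ (c + g.val + walkExp u g.val) - ω ^ (2 * (c + g.val + walkExp u g.val)) := by
  unfold liveInd
  generalize c + g.val + walkExp u g.val = m
  rw [omega_pow_mod hω m, omega_pow_mod hω (2 * m)]
  have hm : m % 3 < 3 := Nat.mod_lt _ (by norm_num)
  have h2 : (2 * m) % 3 = (2 * (m % 3)) % 3 := by omega
  rw [h2]
  interval_cases hm3 : m % 3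
  · simp
    norm_num
  · simp only [ne_eq, one_ne_zero, not_false_eq_true, if_true, mul_one, pow_one]
    norm_num
    linear_combination hω
  · simp only [ne_eq, OfNat.ofNat_ne_zero, not_false_eq_true, if_true, mul_one]
    norm_num
    linear_combination hω

end Omega

/-! ## Twisted characters are killed by the dual functional -/
section Characters
variable {L : Type*} [Field L] {n : ℕ}

/-- `ω^{2 e_g(u)} = χ_{conj (aPat g)}(u)` (square of the path character is the conjugate-path character). -/
theorem omega_pow_two_mul_walkExp {ω : L} (hω : ω ^ 2 + ω + 1 = 0) (u : Fin n → Bool) (g : ℕ) :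
    ω ^ (2 * walkExp u g) = chiK ω (conj (aPat g)) u := by
  rw [mul_comm, pow_mul, omega_pow_walkExp_K, chiK_sq hω]

/-- **the key orthogonality** (hypothesis-free): `L_a(u^S · χ_b) = 0` as soon as `|S| < dist(a, b)` — some
coordinate `i ∉ S` has `a_i ≠ b_i`, and there `W(a_i,0) + ω^{lett b_i}·W(a_i,1) = 0`. -/
theorem LfunK_mono_mul_chiK (ω : L) (S : Finset (Fin n)) (a b : Fin n → Bool) (h : S.card < pdist a b) :
    LfunK ω a (fun u => mono L S u * chiK ω b u) = 0 := by
  classical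
  unfold LfunK
  have e : ∀ u : Fin n → Bool, mono L S u * chiK ω b u * ∏ i, dualW ω (a i) (u i) =
      ∏ i, ((if i ∈ S then (if u i then (1 : L) else 0) else 1) *
        ((if u i then ω ^ lett (b i) else 1) * dualW ω (a i) (u i))) := by
    intro u
    rw [Finset.prod_mul_distrib, Finset.prod_mul_distrib]
    unfold mono chiK
    rw [mul_assoc]
    congr 1
    rw [← Finset.prod_filter, Finset.filter_mem_eq_inter, Finset.univ_inter]
  rw [Finset.sum_congr rfl fun u _ => e u]
  have hps := Finset.prod_univ_sum (fun _ : Fin n => (univ : Finset Bool))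
    (fun i bb => (if i ∈ S then (if bb then (1 : L) else 0) else 1) *
        ((if bb then ω ^ lett (b i) else 1) * dualW ω (a i) bb))
  rw [Fintype.piFinset_univ] at hps
  rw [← hps]
  obtain ⟨i, hiS, hab⟩ : ∃ i, i ∉ S ∧ a i ≠ b i := by
    by_contra hne
    push Not at hne
    refine absurd h (not_lt.2 ?_)
    unfold pdist
    refine Finset.card_le_card fun i hi => ?_
    rw [Finset.mem_filter] at hi
    by_contra hiS
    exact hi.2 (hne i hiS)
  refine Finset.prod_eq_zero (Finset.mem_univ i) ?_
  have hb : b i = !a i := by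
    cases ha : a i <;> cases hb : b i <;> simp_all
  rw [Fintype.sum_bool]
  unfold dualW lett
  cases ha : a i <;> simp [hiS, hb, ha]

/-- `L_a` kills `Y · χ_b` for every `Y` of degree `< dist(a, b)` (hypothesis-free). -/
theorem LfunK_lowDeg_mul_chiK (ω : L) {d : ℕ} {Y : CubeFn L n} (hY : Y ∈ lowDeg L n d)
    (a b : Fin n → Bool) (h : d < pdist a b) : LfunK ω a (fun u => Y u * chiK ω b u) = 0 := by
  rw [lowDeg_eq_span] at hY
  induction hY using Submodule.span_induction with
  | mem f hf =>
    obtain ⟨⟨S, hS⟩, rfl⟩ := hf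
    exact LfunK_mono_mul_chiK ω S a b (lt_of_le_of_lt hS h)
  | zero => simp [LfunK]
  | add f g _ _ hf hg =>
    have e : (fun u => (f + g) u * chiK ω b u) = (fun u => f u * chiK ω b u) + (fun u => g u * chiK ω b u) := by
      funext u; simp only [Pi.add_apply]; ring
    rw [e, LfunK_add, hf, hg, add_zero]
  | smul r f _ hf =>
    have e : (fun u => (r • f) u * chiK ω b u) = r • (fun u => f u * chiK ω b u) := by
      funext u; simp only [Pi.smul_apply, smul_eq_mul]; ring
    rw [e, LfunK_smul, hf, mul_zero]

end Characters

end Summit.QuantumAdvantage.QuantumAdvantage.Theorems.PumpDial
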